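import Literature.NumberTheory.LFunctions.RiemannSiegelFacts
import Mathlib.NumberTheory.LSeries.RiemannZeta
import Mathlib.Analysis.Complex.CauchyIntegral
import Mathlib.Analysis.SpecialFunctions.ExpDeriv
import Mathlib.Analysis.Calculus.ContDiff.Deriv
import HarnessLib

/-!
# Crux `SigmaL` (stmt-RiemannHypothesis-24253) — Hardy's `Z` is `C^∞` (indeed `C^ω`)

Helper for the `SigmaL` lines (skeleton `SigmaL_birth`, stub `stub_laguerreAtCritical` speaks of
`deriv (deriv hardyZ)`): Hardy's function `Z(t) = Re (e^{iθ(t)} ζ(½ + it))`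
(`Literature.NumberTheory.LFunctions.hardyZ`) is `C^n` on `ℝ` for every `n : WithTop ℕ∞`, `ω` included,
hence twice differentiable everywhere, with `deriv Z` differentiable and
`HasDerivAt (deriv Z) (deriv (deriv Z) t) t` at every `t`.

Ingredients: `θ` is `C^n` (`Literature.NumberTheory.LFunctions.contDiff_riemannSiegelTheta_holds`),
`exp` is `C^n`, and `ζ` is holomorphic on the open set `ℂ ∖ {1}` (`differentiableAt_riemannZeta`), hence
`C^n` there (`DifferentiableOn.contDiffOn`), and the critical line misses `s = 1`.
Folklore (Titchmarsh §4.17; Edwards §6.5). Nothing here bears on the truth of RH.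
-/

set_option linter.dupNamespace false

noncomputable section

open Complex
open Literature.NumberTheory.LFunctions

namespace Summit.RiemannHypothesis.RiemannHypothesis.Theorems.SigmaLBirth

/-- The critical line misses the pole: `½ + it ≠ 1`. [folklore] -/
theorem half_add_mul_I_ne_one (t : ℝ) : (1 / 2 : ℂ) + (t : ℂ) * I ≠ 1 := by
  intro h
  have := congrArg Complex.re h
  norm_num at this

/-- `t ↦ ζ(½ + it)` is `C^n` on `ℝ` for every `n : WithTop ℕ∞` (`ζ` is holomorphic on the open set
`ℂ ∖ {1}`, so `C^n` there over `ℂ`, hence over `ℝ`; compose with the affine map `t ↦ ½ + it`).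
[folklore] -/
theorem contDiff_riemannZeta_critLine {n : WithTop ℕ∞} :
    ContDiff ℝ n (fun t : ℝ ↦ riemannZeta (1 / 2 + (t : ℂ) * I)) := by
  have hopen : IsOpen ({1}ᶜ : Set ℂ) := isOpen_compl_singleton
  have hdiff : DifferentiableOn ℂ riemannZeta ({1}ᶜ : Set ℂ) := fun s hs ↦
    (differentiableAt_riemannZeta hs).differentiableWithinAt
  have hcd : ContDiffOn ℂ n riemannZeta ({1}ᶜ : Set ℂ) := hdiff.contDiffOn hopen
  have hcdR : ContDiffOn ℝ n riemannZeta ({1}ᶜ : Set ℂ) := hcd.restrict_scalars ℝ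
  have hline : ContDiff ℝ n (fun t : ℝ ↦ (1 / 2 : ℂ) + (t : ℂ) * I) :=
    contDiff_const.add (Complex.ofRealCLM.contDiff.mul contDiff_const)
  exact hcdR.comp_contDiff hline fun t ↦ half_add_mul_I_ne_one t

/-- The phase factor `t ↦ e^{iθ(t)}` is `C^n` on `ℝ` for every `n` (`θ` is `C^n`,
`contDiff_riemannSiegelTheta_holds`). [folklore] -/
theorem contDiff_cexp_theta {n : WithTop ℕ∞} :
    ContDiff ℝ n (fun t : ℝ ↦ cexp ((riemannSiegelTheta t : ℂ) * I)) := by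
  have hθ : ContDiff ℝ n (fun t : ℝ ↦ (riemannSiegelTheta t : ℂ) * I) :=
    (Complex.ofRealCLM.contDiff.comp contDiff_riemannSiegelTheta_holds).mul contDiff_const
  exact Complex.contDiff_exp.comp hθ

/-- **Hardy's `Z` is `C^n` on `ℝ` for every `n : WithTop ℕ∞`** (`ω` included: `Z` is real-analytic).
[folklore] -/
theorem contDiff_hardyZ {n : WithTop ℕ∞} : ContDiff ℝ n hardyZ := by
  have hF : ContDiff ℝ n
      (fun t : ℝ ↦ cexp ((riemannSiegelTheta t : ℂ) * I) * riemannZeta (1 / 2 + (t : ℂ) * I)) :=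
    contDiff_cexp_theta.mul contDiff_riemannZeta_critLine
  have e : hardyZ = fun t : ℝ ↦
      (cexp ((riemannSiegelTheta t : ℂ) * I) * riemannZeta (1 / 2 + (t : ℂ) * I)).re := rfl
  rw [e]
  exact Complex.reCLM.contDiff.comp hF

/-- `Z` is differentiable on `ℝ`. [folklore] -/
theorem differentiable_hardyZ : Differentiable ℝ hardyZ :=
  (contDiff_hardyZ (n := 1)).differentiable one_ne_zero

/-- `Z'` is `C^n` on `ℝ` for every `n`. [folklore] -/
theorem contDiff_deriv_hardyZ {n : WithTop ℕ∞} : ContDiff ℝ n (deriv hardyZ) := by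
  have h := contDiff_hardyZ (n := n + 1)
  rw [contDiff_succ_iff_deriv] at h
  exact h.2.2

/-- `Z'` is differentiable on `ℝ` (so `Z` is twice differentiable everywhere). [folklore] -/
theorem differentiable_deriv_hardyZ : Differentiable ℝ (deriv hardyZ) :=
  (contDiff_deriv_hardyZ (n := 1)).differentiable one_ne_zero

/-- `Z'` has derivative `Z'' = deriv (deriv Z)` at every point. [folklore] -/
theorem hasDerivAt_deriv_hardyZ (t : ℝ) :
    HasDerivAt (deriv hardyZ) (deriv (deriv hardyZ) t) t :=
  (differentiable_deriv_hardyZ t).hasDerivAt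

/-- `Z''` is continuous. [folklore] -/
theorem continuous_deriv_deriv_hardyZ : Continuous (deriv (deriv hardyZ)) := by
  have h := contDiff_deriv_hardyZ (n := 1)
  rw [show (1 : WithTop ℕ∞) = 0 + 1 from rfl, contDiff_succ_iff_deriv] at h
  exact h.2.2.continuous

end Summit.RiemannHypothesis.RiemannHypothesis.Theorems.SigmaLBirth

end
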